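import Summits.QuantumFields.YangMills.Theorems.UnitScaleTiltProp7HolRatioPerStep
import HarnessLib

/-!
# Route `UnitScaleTilt`, crux K1 child «MinimiserStabilityRegPr» (stmt-QuantumFields-19200), line «route-R», stub S ∕ (CV) — DEFINITIONS FILE: THE EXACT
# FIRST-ORDER AND ORDERED PAIR SUMS OF THE RELATIVE STEP TERMS ALONG A WALK, and the SECOND-ORDER per-step expansion of the relative holonomy
# `‖U(Γ)U₀(Γ)^* − 1 − W₁(Γ) − W₂(Γ)‖ ≤ e^t − 1 − t − t²/2`, `t = Σ_{s∈Γ}‖Y_{b(s)}‖`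

Cell `ym3-torus` ∕ fleet seat `ym-ust-19200-p1` (gen 10; HUMAN RULING D-0037, YM ladder rung R3).  WHY.  Gen 4's `Prop7HolRatioPerStep.norm_holRatio_bounds_perStep`
expands the relative holonomy `D(Γ) = U(Γ)U₀(Γ)^* − 1` of `U = (1+Y)U₀` along a walk to FIRST order (`D = Y_{U₀}(Γ) + O(t²)`).  The constraint-velocity bound (CV) to
which stub S of route-R reduces (w1-19200 `Prop7FirstVariation*`; route-R card §2(b)) is a statement about the SECOND-order part of the k-fold (0.4)-average along a
secant, i.e. about the ordered pair products of the step terms along the (0.4) contours: their structure (after the mean over contours and the pairing with the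
multipliers, the coefficient of a comb-tree pair is the current `J` of the downstream bond) is what makes a k-uniform (CV) possible.  This file gives the exact
objects and the exact second-order expansion in the tree's walk letters (`LStep`, `stepFactor`, `holAt`, `covWalkSum` of `BlockAveragingEMLLinearised(Background)`),
complementing the abstract `Fin`-indexed version `Prop7OrderedProductExpansion` (p592676, with the identity `2Σ_{i<j}A_iA_j = (ΣA)² − ΣA_i² + Σ_{i<j}[A_i,A_j]`).

WHAT IS DEFINED (`U₀, U : GaugeField P j SU(n)`, `Γ : List (LStep P j)`, `g_s = stepFactor U₀ s`):
* `zStep U₀ U s := stepFactor U s · (stepFactor U₀ s)^* − 1` — the EXACT relative step term (`= Y_b` forward, `= g_s Y_b^* g_s^*` backward; gen 4's `Z_s`);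
* `zWalkSum U₀ U Γ` — `W₁(s·Γ) = Z_s + g_s W₁(Γ) g_s^*` (the exact twin of the first-order `covWalkSum U₀ Y Γ`, from which it differs by `≤ Σ‖Y_b‖²`);
* `pairWalkSum U₀ U Γ` — `W₂(s·Γ) = Z_s·(g_s W₁(Γ) g_s^*) + g_s W₂(Γ) g_s^*` (the ORDERED pair sum `Σ_{i<j} Z̃_i Z̃_j` of the transported step terms).
WHAT IS PROVED (sorry-free).  `zWalkSum_nil/_cons`, `pairWalkSum_nil/_cons` (rfl), `norm_zStep_le` (`‖Z_s‖ ≤ ‖Y_b‖`), `norm_zStep_sub_covStep_le` (`≤ ‖Y_b‖²`),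
`holRatio_cons` (`1 + D(s·Γ) = (1 + Z_s)·g_s(1 + D(Γ))g_s^*` read as `D′ = Z + gDg^* + Z·gDg^*`), **`norm_holRatio_taylor_perStep`** (the three bounds
`‖D‖ ≤ e^t − 1`, `‖D − W₁‖ ≤ e^t − 1 − t`, `‖D − W₁ − W₂‖ ≤ e^t − 1 − t − t²/2`), **`norm_zWalkSum_sub_covWalkSum_le`** (`‖W₁(Γ) − Y_{U₀}(Γ)‖ ≤ Σ_{s∈Γ}‖Y_{b(s)}‖²`).

HONEST SCOPE.  Definitions of bookkeeping objects the route posits (S∕(CV) supplier letters) and their elementary expansion; nothing of [Balaban1985Averaging] or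
[Balaban1985Variational] is asserted; count-neutral toward stmt-QuantumFields-19200 (`--supports`).  Not a claim about the continuum limit or the mass gap.

References: T. Bałaban, CMP 98 (1985) 17–51 [Balaban1985Averaging] ((56)–(58) p.27, (122)–(123) p.36); CMP 102 (1985) 277–309 [Balaban1985Variational] ((44) p.285,
(141)–(143) p.299).
-/

noncomputable section

open scoped BigOperators Matrix.Norms.L2Operator

namespace Summit.QuantumFields.YangMills.Theorems.Prop7WalkPair

open Literature.MathematicalPhysics.QuantumFieldTheory.Balaban1983to89
open T4Continuum BlockAveraging BlockAveragingEMLLinearised BlockAveragingEMLLinearisedBackground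
open Summit.QuantumFields.YangMills.Theorems.Prop7HolRatioPerStep (stepFactor_mul_star' star_mul_stepFactor' norm_conj_stepFactor_le' norm_star_sub_one_eq)

variable {n : Type*} [Fintype n] [DecidableEq n] [Nonempty n] {P : Params} {j : ℕ}

/-! ## §1 Definitions -/

/-- **THE EXACT RELATIVE STEP TERM** `Z_s = f_s·g_s^* − 1` (`f_s, g_s` the step factors of `U`, `U₀`): `= Y_b` on a forward step, `= g_s Y_b^* g_s^*` on a backward one.
[cite: Balaban1985Averaging, (56)-(58) p.27] -/
def zStep (U₀ U : GaugeField P j (Matrix.specialUnitaryGroup n ℂ)) (s : LStep P j) : Matrix n n ℂ :=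
  stepFactor U s * star (stepFactor U₀ s) - 1

/-- **THE EXACT FIRST-ORDER SUM ALONG A WALK**: `W₁(s·Γ) = Z_s + g_s·W₁(Γ)·g_s^*`, `W₁(∅) = 0` (exact twin of `covWalkSum`). [cite: Balaban1985Averaging, (58) p.27] -/
def zWalkSum (U₀ U : GaugeField P j (Matrix.specialUnitaryGroup n ℂ)) : List (LStep P j) → Matrix n n ℂ
  | [] => 0
  | s :: γ => zStep U₀ U s + stepFactor U₀ s * zWalkSum U₀ U γ * star (stepFactor U₀ s)

/-- **THE ORDERED PAIR SUM ALONG A WALK**: `W₂(s·Γ) = Z_s·(g_s W₁(Γ) g_s^*) + g_s·W₂(Γ)·g_s^*`, `W₂(∅) = 0` — the sum over ordered pairs of steps `i < j` of the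
products `Z̃_i Z̃_j` of the step terms transported to the start of the walk. [cite: Balaban1985Averaging, (58) p.27, (122)-(123) p.36] -/
def pairWalkSum (U₀ U : GaugeField P j (Matrix.specialUnitaryGroup n ℂ)) : List (LStep P j) → Matrix n n ℂ
  | [] => 0
  | s :: γ => zStep U₀ U s * (stepFactor U₀ s * zWalkSum U₀ U γ * star (stepFactor U₀ s))
      + stepFactor U₀ s * pairWalkSum U₀ U γ * star (stepFactor U₀ s)

omit [Nonempty n] in
/-- [folklore] -/
@[simp] theorem zWalkSum_nil (U₀ U : GaugeField P j (Matrix.specialUnitaryGroup n ℂ)) : zWalkSum U₀ U [] = 0 := rfl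

omit [Nonempty n] in
/-- [folklore] -/
theorem zWalkSum_cons (U₀ U : GaugeField P j (Matrix.specialUnitaryGroup n ℂ)) (s : LStep P j) (γ : List (LStep P j)) :
    zWalkSum U₀ U (s :: γ) = zStep U₀ U s + stepFactor U₀ s * zWalkSum U₀ U γ * star (stepFactor U₀ s) := rfl

omit [Nonempty n] in
/-- [folklore] -/
@[simp] theorem pairWalkSum_nil (U₀ U : GaugeField P j (Matrix.specialUnitaryGroup n ℂ)) : pairWalkSum U₀ U [] = 0 := rfl

omit [Nonempty n] in
/-- [folklore] -/
theorem pairWalkSum_cons (U₀ U : GaugeField P j (Matrix.specialUnitaryGroup n ℂ)) (s : LStep P j) (γ : List (LStep P j)) :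
    pairWalkSum U₀ U (s :: γ) = zStep U₀ U s * (stepFactor U₀ s * zWalkSum U₀ U γ * star (stepFactor U₀ s))
      + stepFactor U₀ s * pairWalkSum U₀ U γ * star (stepFactor U₀ s) := rfl

/-! ## §2 The step term: size and first-order part -/

/-- **`‖Z_s‖ ≤ ‖Y_{b(s)}‖`** (equality in fact), `Y = pertVar U₀ U`. [cite: Balaban1985Averaging, (56)-(58) p.27] -/
theorem norm_zStep_le (U₀ U : GaugeField P j (Matrix.specialUnitaryGroup n ℂ)) (s : LStep P j) :
    ‖zStep U₀ U s‖ ≤ ‖pertVar U₀ U s.bond‖ := by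
  have hfg := stepFactor_mul_star_stepFactor U₀ U s
  have hgg : stepFactor U₀ s * star (stepFactor U₀ s) = 1 := stepFactor_mul_star' U₀ s
  unfold zStep
  revert hfg
  cases s.fwd <;> intro hfg
  · simp only [Bool.false_eq_true, ↓reduceIte] at hfg
    have eZ : stepFactor U s * star (stepFactor U₀ s) - 1 = stepFactor U₀ s * (star (1 + pertVar U₀ U s.bond) - 1) * star (stepFactor U₀ s) := by
      rw [hfg, mul_sub, sub_mul, mul_one, hgg]
    have h1Y : 1 + pertVar U₀ U s.bond = (((U s.bond * (U₀ s.bond)⁻¹ : Matrix.specialUnitaryGroup n ℂ) : Matrix n n ℂ)) := by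
      rw [pertVar, add_sub_cancel]
    rw [eZ]
    refine (norm_conj_stepFactor_le' U₀ s _).trans (le_of_eq ?_)
    rw [h1Y, norm_star_sub_one_eq, pertVar]
  · simp only [↓reduceIte] at hfg
    rw [hfg, add_sub_cancel_left]

/-- **`‖Z_s − covStep_s‖ ≤ ‖Y_{b(s)}‖²`**: the exact step term and its first-order part differ by `g_s(Y_b^* + Y_b)g_s^* = −g_sY_bY_b^*g_s^*` on a backward step, by `0` on a
forward one. [cite: Balaban1985Averaging, (56)-(58) p.27] -/
theorem norm_zStep_sub_covStep_le (U₀ U : GaugeField P j (Matrix.specialUnitaryGroup n ℂ)) (s : LStep P j) :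
    ‖zStep U₀ U s - covStep U₀ (pertVar U₀ U) s‖ ≤ ‖pertVar U₀ U s.bond‖ ^ 2 := by
  have hfg := stepFactor_mul_star_stepFactor U₀ U s
  have hgg : stepFactor U₀ s * star (stepFactor U₀ s) = 1 := stepFactor_mul_star' U₀ s
  unfold zStep covStep
  revert hfg
  cases s.fwd <;> intro hfg
  · simp only [Bool.false_eq_true, ↓reduceIte] at hfg ⊢
    have e2 : stepFactor U₀ s * star (1 + pertVar U₀ U s.bond) * star (stepFactor U₀ s) - 1
          - -(stepFactor U₀ s * pertVar U₀ U s.bond * star (stepFactor U₀ s))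
        = stepFactor U₀ s * (star (1 + pertVar U₀ U s.bond) - 1 + pertVar U₀ U s.bond) * star (stepFactor U₀ s) := by
      have h' : stepFactor U₀ s * (star (1 + pertVar U₀ U s.bond) - 1 + pertVar U₀ U s.bond) * star (stepFactor U₀ s)
          = stepFactor U₀ s * star (1 + pertVar U₀ U s.bond) * star (stepFactor U₀ s) - stepFactor U₀ s * star (stepFactor U₀ s)
            + stepFactor U₀ s * pertVar U₀ U s.bond * star (stepFactor U₀ s) := by noncomm_ring
      rw [h', hgg]; noncomm_ring
    rw [hfg, e2]
    refine (norm_conj_stepFactor_le' U₀ s _).trans ?_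
    have h1Y : 1 + pertVar U₀ U s.bond = (((U s.bond * (U₀ s.bond)⁻¹ : Matrix.specialUnitaryGroup n ℂ) : Matrix n n ℂ)) := by
      rw [pertVar, add_sub_cancel]
    have h3 : star (1 + pertVar U₀ U s.bond) - 1 + pertVar U₀ U s.bond =
        star (((U s.bond * (U₀ s.bond)⁻¹ : Matrix.specialUnitaryGroup n ℂ) : Matrix n n ℂ)) - 1 +
          ((((U s.bond * (U₀ s.bond)⁻¹ : Matrix.specialUnitaryGroup n ℂ) : Matrix n n ℂ)) - 1) := by
      rw [← h1Y, add_sub_cancel_left]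
    rw [h3, pertVar]
    exact norm_holRatio_bounds.norm_star_sub_one_add_le' _
  · simp only [↓reduceIte] at hfg ⊢
    rw [hfg, add_sub_cancel_left, sub_self, norm_zero]
    positivity

/-! ## §3 The recursion of the relative holonomy and the second-order expansion -/

/-- **THE STEP RECURSION OF THE RELATIVE HOLONOMY**: `D(s·Γ) = Z_s + g_sD(Γ)g_s^* + Z_s·g_sD(Γ)g_s^*`, `D(Γ) = U(Γ)U₀(Γ)^* − 1`. [cite: Balaban1985Averaging, (122)-(123) p.36] -/
theorem holRatio_cons (U₀ U : GaugeField P j (Matrix.specialUnitaryGroup n ℂ)) (s : LStep P j) (γ : List (LStep P j)) :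
    ((holAt U (s :: γ) : Matrix.specialUnitaryGroup n ℂ) : Matrix n n ℂ) * star ((holAt U₀ (s :: γ) : Matrix.specialUnitaryGroup n ℂ) : Matrix n n ℂ) - 1
      = zStep U₀ U s
        + stepFactor U₀ s * (((holAt U γ : Matrix.specialUnitaryGroup n ℂ) : Matrix n n ℂ) * star ((holAt U₀ γ : Matrix.specialUnitaryGroup n ℂ) : Matrix n n ℂ) - 1)
            * star (stepFactor U₀ s)
        + zStep U₀ U s * (stepFactor U₀ s
            * (((holAt U γ : Matrix.specialUnitaryGroup n ℂ) : Matrix n n ℂ) * star ((holAt U₀ γ : Matrix.specialUnitaryGroup n ℂ) : Matrix n n ℂ) - 1)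
            * star (stepFactor U₀ s)) := by
  have hF' : ((holAt U (s :: γ) : Matrix.specialUnitaryGroup n ℂ) : Matrix n n ℂ) = stepFactor U s * ((holAt U γ : Matrix.specialUnitaryGroup n ℂ) : Matrix n n ℂ) := by
    rw [coe_holAt_eq_prod_stepFactor, List.map_cons, List.prod_cons, ← coe_holAt_eq_prod_stepFactor]
  have hF₀' : ((holAt U₀ (s :: γ) : Matrix.specialUnitaryGroup n ℂ) : Matrix n n ℂ) = stepFactor U₀ s * ((holAt U₀ γ : Matrix.specialUnitaryGroup n ℂ) : Matrix n n ℂ) := by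
    rw [coe_holAt_eq_prod_stepFactor, List.map_cons, List.prod_cons, ← coe_holAt_eq_prod_stepFactor]
  have hgg' : star (stepFactor U₀ s) * stepFactor U₀ s = 1 := star_mul_stepFactor' U₀ s
  rw [hF', hF₀', star_mul, zStep]
  set f := stepFactor U s
  set g := stepFactor U₀ s
  set F := ((holAt U γ : Matrix.specialUnitaryGroup n ℂ) : Matrix n n ℂ)
  set F₀ := ((holAt U₀ γ : Matrix.specialUnitaryGroup n ℂ) : Matrix n n ℂ)
  have e1 : (f * star g - 1) * (g * (F * star F₀ - 1) * star g) = f * (star g * g) * (F * star F₀ - 1) * star g - g * (F * star F₀ - 1) * star g := by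
    noncomm_ring
  rw [e1, hgg', mul_one]
  noncomm_ring

/-- **THE RELATIVE HOLONOMY TO SECOND ORDER, PER STEP**: with `t = Σ_{s∈Γ}‖Y_{b(s)}‖`, `D(Γ) = U(Γ)U₀(Γ)^* − 1`, `W₁ = zWalkSum`, `W₂ = pairWalkSum`:
`‖D(Γ)‖ ≤ e^t − 1`, `‖D(Γ) − W₁(Γ)‖ ≤ e^t − 1 − t`, **`‖D(Γ) − W₁(Γ) − W₂(Γ)‖ ≤ e^t − 1 − t − t²/2`** (`≤ (t³/6)e^t`).  Recursions `R₂′ = gR₂g^* + Z·gR₁g^*`,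
`R₃′ = gR₃g^* + Z·gR₂g^*`. [cite: Balaban1985Averaging, (122)-(123) p.36] -/
theorem norm_holRatio_taylor_perStep (U₀ U : GaugeField P j (Matrix.specialUnitaryGroup n ℂ)) :
    ∀ γ : List (LStep P j),
      ‖((holAt U γ : Matrix.specialUnitaryGroup n ℂ) : Matrix n n ℂ) * star ((holAt U₀ γ : Matrix.specialUnitaryGroup n ℂ) : Matrix n n ℂ) - 1‖
          ≤ Real.exp ((γ.map fun s => ‖pertVar U₀ U s.bond‖).sum) - 1 ∧
      ‖((holAt U γ : Matrix.specialUnitaryGroup n ℂ) : Matrix n n ℂ) * star ((holAt U₀ γ : Matrix.specialUnitaryGroup n ℂ) : Matrix n n ℂ) - 1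
          - zWalkSum U₀ U γ‖
          ≤ Real.exp ((γ.map fun s => ‖pertVar U₀ U s.bond‖).sum) - 1 - (γ.map fun s => ‖pertVar U₀ U s.bond‖).sum ∧
      ‖((holAt U γ : Matrix.specialUnitaryGroup n ℂ) : Matrix n n ℂ) * star ((holAt U₀ γ : Matrix.specialUnitaryGroup n ℂ) : Matrix n n ℂ) - 1
          - zWalkSum U₀ U γ - pairWalkSum U₀ U γ‖
          ≤ Real.exp ((γ.map fun s => ‖pertVar U₀ U s.bond‖).sum) - 1 - (γ.map fun s => ‖pertVar U₀ U s.bond‖).sum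
            - ((γ.map fun s => ‖pertVar U₀ U s.bond‖).sum) ^ 2 / 2
  | [] => by simp [holAt_nil]
  | s :: γ => by
    obtain ⟨ih₁, ih₂, ih₃⟩ := norm_holRatio_taylor_perStep U₀ U γ
    rw [holRatio_cons, zWalkSum_cons, pairWalkSum_cons, List.map_cons, List.sum_cons]
    set g : Matrix n n ℂ := stepFactor U₀ s with hg
    set D : Matrix n n ℂ := ((holAt U γ : Matrix.specialUnitaryGroup n ℂ) : Matrix n n ℂ) * star ((holAt U₀ γ : Matrix.specialUnitaryGroup n ℂ) : Matrix n n ℂ) - 1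
      with hD
    set W₁ : Matrix n n ℂ := zWalkSum U₀ U γ with hW₁
    set W₂ : Matrix n n ℂ := pairWalkSum U₀ U γ with hW₂
    set Z : Matrix n n ℂ := zStep U₀ U s with hZ
    set t : ℝ := (γ.map fun s => ‖pertVar U₀ U s.bond‖).sum with ht
    set b : ℝ := ‖pertVar U₀ U s.bond‖ with hb
    have hb0 : 0 ≤ b := norm_nonneg _
    have ht0 : 0 ≤ t := by
      rw [ht]; exact List.sum_nonneg (by intro x hx; obtain ⟨y, -, rfl⟩ := List.mem_map.mp hx; exact norm_nonneg _)
    have hZb : ‖Z‖ ≤ b := norm_zStep_le U₀ U s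
    have het : 1 ≤ Real.exp t := by have := Real.add_one_le_exp t; linarith
    have heb := Real.add_one_le_exp b
    have hqb := Real.quadratic_le_exp_of_nonneg hb0
    have hconj : ∀ X : Matrix n n ℂ, ‖g * X * star g‖ ≤ ‖X‖ := fun X => norm_conj_stepFactor_le' U₀ s X
    refine ⟨?_, ?_, ?_⟩
    · -- `‖Z + gDg* + Z gDg*‖ ≤ b + r₁ + b r₁ ≤ e^{b+t} − 1`
      have h1 := hconj D
      calc ‖Z + g * D * star g + Z * (g * D * star g)‖ ≤ ‖Z‖ + ‖g * D * star g‖ + ‖Z‖ * ‖g * D * star g‖ :=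
            (norm_add_le _ _).trans (add_le_add (norm_add_le _ _) (norm_mul_le _ _))
        _ ≤ b + (Real.exp t - 1) + b * (Real.exp t - 1) :=
            add_le_add (add_le_add hZb (h1.trans ih₁)) (mul_le_mul hZb (h1.trans ih₁) (norm_nonneg _) hb0)
        _ = (1 + b) * Real.exp t - 1 := by ring
        _ ≤ Real.exp (b + t) - 1 := by
            rw [Real.exp_add]
            nlinarith [heb, het, mul_le_mul_of_nonneg_right (by linarith [heb] : 1 + b ≤ Real.exp b) (Real.exp_pos t).le]
    · -- `R₂′ = g R₂ g* + Z·gDg*`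
      have e : Z + g * D * star g + Z * (g * D * star g) - (Z + g * W₁ * star g) = g * (D - W₁) * star g + Z * (g * D * star g) := by noncomm_ring
      rw [e]
      calc ‖g * (D - W₁) * star g + Z * (g * D * star g)‖ ≤ ‖g * (D - W₁) * star g‖ + ‖Z‖ * ‖g * D * star g‖ :=
            (norm_add_le _ _).trans (add_le_add le_rfl (norm_mul_le _ _))
        _ ≤ (Real.exp t - 1 - t) + b * (Real.exp t - 1) :=
            add_le_add ((hconj _).trans ih₂) (mul_le_mul hZb ((hconj D).trans ih₁) (norm_nonneg _) hb0)
        _ ≤ Real.exp (b + t) - 1 - (b + t) := by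
            rw [Real.exp_add]
            nlinarith [heb, het, mul_le_mul_of_nonneg_right heb (Real.exp_pos t).le]
    · -- `R₃′ = g R₃ g* + Z·g R₂ g*`
      have e : Z + g * D * star g + Z * (g * D * star g) - (Z + g * W₁ * star g) - (Z * (g * W₁ * star g) + g * W₂ * star g)
          = g * (D - W₁ - W₂) * star g + Z * (g * (D - W₁) * star g) := by noncomm_ring
      rw [e]
      calc ‖g * (D - W₁ - W₂) * star g + Z * (g * (D - W₁) * star g)‖ ≤ ‖g * (D - W₁ - W₂) * star g‖ + ‖Z‖ * ‖g * (D - W₁) * star g‖ :=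
            (norm_add_le _ _).trans (add_le_add le_rfl (norm_mul_le _ _))
        _ ≤ (Real.exp t - 1 - t - t ^ 2 / 2) + b * (Real.exp t - 1 - t) :=
            add_le_add ((hconj _).trans ih₃) (mul_le_mul hZb ((hconj _).trans ih₂) (norm_nonneg _) hb0)
        _ ≤ Real.exp (b + t) - 1 - (b + t) - (b + t) ^ 2 / 2 := by
            rw [Real.exp_add]
            have hk : 0 ≤ Real.exp b - 1 - b - b ^ 2 / 2 := by linarith [hqb]
            have hm : (Real.exp b - 1 - b) * 1 ≤ (Real.exp b - 1 - b) * Real.exp t :=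
              mul_le_mul_of_nonneg_left het (by nlinarith [hqb, sq_nonneg b])
            nlinarith [hk, hm]

/-! ## §4 The exact first-order sum against the tree's `covWalkSum` -/

/-- **`‖W₁(Γ) − Y_{U₀}(Γ)‖ ≤ Σ_{s∈Γ}‖Y_{b(s)}‖²`** (`Y = pertVar U₀ U`; the difference collects the second-order diagonal corrections `−g_sY_bY_b^*g_s^*` of the backward
steps, SCALAR for `1 + Y_b ∈ SU(2)`). [cite: Balaban1985Averaging, (58) p.27] -/
theorem norm_zWalkSum_sub_covWalkSum_le (U₀ U : GaugeField P j (Matrix.specialUnitaryGroup n ℂ)) :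
    ∀ γ : List (LStep P j), ‖zWalkSum U₀ U γ - covWalkSum U₀ (pertVar U₀ U) γ‖ ≤ (γ.map fun s => ‖pertVar U₀ U s.bond‖ ^ 2).sum
  | [] => by simp
  | s :: γ => by
    have ih := norm_zWalkSum_sub_covWalkSum_le U₀ U γ
    rw [zWalkSum_cons, covWalkSum_cons, List.map_cons, List.sum_cons]
    have e : zStep U₀ U s + stepFactor U₀ s * zWalkSum U₀ U γ * star (stepFactor U₀ s)
          - (covStep U₀ (pertVar U₀ U) s + stepFactor U₀ s * covWalkSum U₀ (pertVar U₀ U) γ * star (stepFactor U₀ s))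
        = (zStep U₀ U s - covStep U₀ (pertVar U₀ U) s)
          + stepFactor U₀ s * (zWalkSum U₀ U γ - covWalkSum U₀ (pertVar U₀ U) γ) * star (stepFactor U₀ s) := by noncomm_ring
    rw [e]
    exact (norm_add_le _ _).trans (add_le_add (norm_zStep_sub_covStep_le U₀ U s) ((norm_conj_stepFactor_le' U₀ s _).trans ih))

end Summit.QuantumFields.YangMills.Theorems.Prop7WalkPair

end
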